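import Mathlib
import Literature.Analysis.FluidPDE.TypeIAncientMild
import Literature.Analysis.FluidPDE.HyperbolicDSSOrbit
import Literature.Analysis.FluidPDE.VorticityCalculus
import Literature.Analysis.FluidPDE.RadialSmoothCutoff

/-!
# drefute evidence — the cheap pieces of the lead's skeleton v1 (line `outward-drift-signed-flux`)

Sorry-free proofs of: `stub_simDictionary` part (i) (`‖U‖ ≤ C`), `stub_gradEnergyBasic` parts (i) and
(iii) (nonnegativity, monotonicity in the radius), `stub_divCurlBalls` parts (iii) and (iv)
(`E(R) ≤ ∫φ_R|∇U|²_F`, `Z_R ↑` in `R`), plus the regularity facts they rest on (slices of the orbit are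
smooth; the Frobenius density and the cut-off enstrophy density are continuous, the latter compactly
supported).  For the lead to paste.
-/

noncomputable section

open MeasureTheory Set Filter Real Metric
open scoped ContDiff
open Literature.Analysis.FluidPDE

namespace Drefute

local notation "ℝ³" => EuclideanSpace ℝ (Fin 3)

variable {C : ℝ} {u : ℝ → ℝ³ → ℝ³}

/-- Slices of the similarity orbit of a class element are smooth. -/
theorem contDiff_lerayOrbit_slice (hu : IsTypeIAncientMild C u) (s : ℝ) {n : ℕ∞} :
    ContDiff ℝ n (lerayOrbit u s) := by
  have h : ContDiff ℝ n (Function.uncurry (lerayOrbit u)) :=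
    contDiff_uncurry_lerayOrbit (hu.1.of_le (by exact_mod_cast le_top))
  exact h.comp (contDiff_prodMk_right s)

/-- **stub_simDictionary (i)**: `‖U(s,y)‖ ≤ C` from H4. -/
theorem norm_lerayOrbit_le (hu : IsTypeIAncientMild C u) (s : ℝ) (y : ℝ³) :
    ‖lerayOrbit u s y‖ ≤ C := by
  have hpos : 0 < Real.exp (-s / 2) := Real.exp_pos _
  have key := hu.2.2.2 (-Real.exp (-s)) (by simpa using Real.exp_pos (-s)) (Real.exp (-s / 2) • y)
  rw [neg_neg, sqrt_exp_neg] at key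
  rw [lerayOrbit_apply, norm_smul, Real.norm_of_nonneg hpos.le]
  calc Real.exp (-s / 2) * ‖u (-Real.exp (-s)) (Real.exp (-s / 2) • y)‖
      ≤ Real.exp (-s / 2) * (C / Real.exp (-s / 2)) := by gcongr
    _ = C := by field_simp

/-- The Frobenius gradient density of a slice is continuous. -/
theorem continuous_frobeniusNormSq_fderiv_lerayOrbit (hu : IsTypeIAncientMild C u) (s : ℝ) :
    Continuous fun y => frobeniusNormSq (fderiv ℝ (lerayOrbit u s) y) := by
  have hc : Continuous (fderiv ℝ (lerayOrbit u s)) :=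
    (contDiff_lerayOrbit_slice hu s (n := 1)).continuous_fderiv one_ne_zero
  unfold frobeniusNormSq
  exact continuous_finsetSum _ fun i _ => ((hc.clm_apply continuous_const).norm).pow 2

/-- The vorticity density of a slice is continuous. -/
theorem continuous_norm_lerayVorticity_sq (hu : IsTypeIAncientMild C u) (s : ℝ) :
    Continuous fun y => ‖lerayVorticity u s y‖ ^ 2 := by
  rw [lerayVorticity_apply]
  exact ((continuous_curl (contDiff_lerayOrbit_slice hu s (n := 1))).norm).pow 2

/-- **stub_gradEnergyBasic (i)**: `0 ≤ E(ρ, s)`. -/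
theorem ballGradEnergy_nonneg (u : ℝ → ℝ³ → ℝ³) (ρ s : ℝ) :
    0 ≤ ∫ y in ball (0 : ℝ³) ρ, frobeniusNormSq (fderiv ℝ (lerayOrbit u s) y) :=
  setIntegral_nonneg measurableSet_ball fun _ _ => frobeniusNormSq_nonneg _

/-- Integrability of the Frobenius density on balls. -/
theorem integrableOn_frobeniusNormSq_ball (hu : IsTypeIAncientMild C u) (s ρ : ℝ) :
    IntegrableOn (fun y => frobeniusNormSq (fderiv ℝ (lerayOrbit u s) y)) (ball (0 : ℝ³) ρ) :=
  (((continuous_frobeniusNormSq_fderiv_lerayOrbit hu s).continuousOn).integrableOn_compact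
    (isCompact_closedBall (0 : ℝ³) ρ)).mono_set ball_subset_closedBall

/-- **stub_gradEnergyBasic (iii)**: monotonicity of `E(ρ, s)` in `ρ`. -/
theorem ballGradEnergy_mono (hu : IsTypeIAncientMild C u) (s ρ ρ' : ℝ) (hρρ' : ρ ≤ ρ') :
    (∫ y in ball (0 : ℝ³) ρ, frobeniusNormSq (fderiv ℝ (lerayOrbit u s) y)) ≤
      ∫ y in ball (0 : ℝ³) ρ', frobeniusNormSq (fderiv ℝ (lerayOrbit u s) y) :=
  setIntegral_mono_set (integrableOn_frobeniusNormSq_ball hu s ρ')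
    (Eventually.of_forall fun _ => frobeniusNormSq_nonneg _)
    (Eventually.of_forall (ball_subset_ball hρρ'))

/-- The cut-off Frobenius density is integrable (compact support). -/
theorem integrable_cutoff_mul_frobeniusNormSq (hu : IsTypeIAncientMild C u) (s : ℝ) {R : ℝ} (hR : 0 < R) :
    Integrable fun y : ℝ³ => smoothTransition (2 - ‖y‖ ^ 2 / R ^ 2) *
      frobeniusNormSq (fderiv ℝ (lerayOrbit u s) y) :=
  (((contDiff_smoothTransition_cutoff (n := 0) R).continuous).mul
    (continuous_frobeniusNormSq_fderiv_lerayOrbit hu s)).integrable_of_hasCompactSupport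
    ((hasCompactSupport_smoothTransition_cutoff hR).mul_right)

/-- The cut-off enstrophy density is integrable (compact support). -/
theorem integrable_cutoff_mul_vorticity (hu : IsTypeIAncientMild C u) (s : ℝ) {R : ℝ} (hR : 0 < R) :
    Integrable fun y : ℝ³ => smoothTransition (2 - ‖y‖ ^ 2 / R ^ 2) * ‖lerayVorticity u s y‖ ^ 2 :=
  (((contDiff_smoothTransition_cutoff (n := 0) R).continuous).mul
    (continuous_norm_lerayVorticity_sq hu s)).integrable_of_hasCompactSupport
    ((hasCompactSupport_smoothTransition_cutoff hR).mul_right)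

/-- **stub_divCurlBalls (iii)**: `E(R) ≤ ∫ φ_R |∇U|²_F` (`φ_R = 1` on `B_R`, integrand `≥ 0`). -/
theorem ballGradEnergy_le_cutoff (hu : IsTypeIAncientMild C u) (s : ℝ) {R : ℝ} (hR : 0 < R) :
    (∫ y in ball (0 : ℝ³) R, frobeniusNormSq (fderiv ℝ (lerayOrbit u s) y)) ≤
      ∫ y, smoothTransition (2 - ‖y‖ ^ 2 / R ^ 2) * frobeniusNormSq (fderiv ℝ (lerayOrbit u s) y) := by
  have hint := integrable_cutoff_mul_frobeniusNormSq hu s hR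
  calc (∫ y in ball (0 : ℝ³) R, frobeniusNormSq (fderiv ℝ (lerayOrbit u s) y))
      = ∫ y in ball (0 : ℝ³) R, smoothTransition (2 - ‖y‖ ^ 2 / R ^ 2) *
          frobeniusNormSq (fderiv ℝ (lerayOrbit u s) y) := by
        refine setIntegral_congr_fun measurableSet_ball fun y hy => ?_
        rw [mem_ball, dist_zero_right] at hy
        rw [smoothTransition_cutoff_eq_one hR hy.le, one_mul]
    _ ≤ ∫ y, smoothTransition (2 - ‖y‖ ^ 2 / R ^ 2) * frobeniusNormSq (fderiv ℝ (lerayOrbit u s) y) :=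
        setIntegral_le_integral hint (Eventually.of_forall fun y =>
          mul_nonneg (smoothTransition_cutoff_nonneg R y) (frobeniusNormSq_nonneg _))

/-- **stub_divCurlBalls (iv)**: `Z_R ≤ Z_{R'}` for `0 < R ≤ R'` (the cutoffs are ordered). -/
theorem cutoffEnstrophy_mono (hu : IsTypeIAncientMild C u) (s : ℝ) {R R' : ℝ} (hR : 0 < R) (hRR' : R ≤ R') :
    (∫ y, smoothTransition (2 - ‖y‖ ^ 2 / R ^ 2) * ‖lerayVorticity u s y‖ ^ 2) ≤
      ∫ y, smoothTransition (2 - ‖y‖ ^ 2 / R' ^ 2) * ‖lerayVorticity u s y‖ ^ 2 := by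
  have hR' : 0 < R' := lt_of_lt_of_le hR hRR'
  refine integral_mono (integrable_cutoff_mul_vorticity hu s hR) (integrable_cutoff_mul_vorticity hu s hR')
    fun y => ?_
  refine mul_le_mul_of_nonneg_right (Real.smoothTransition.monotone ?_) (sq_nonneg _)
  have h : ‖y‖ ^ 2 / R' ^ 2 ≤ ‖y‖ ^ 2 / R ^ 2 :=
    div_le_div_of_nonneg_left (sq_nonneg _) (by positivity) (pow_le_pow_left₀ hR.le hRR' 2)
  linarith

/-- The Frobenius gradient density is jointly continuous in `(s, y)`. -/
theorem continuous_frobeniusNormSq_fderiv_lerayOrbit_uncurry (hu : IsTypeIAncientMild C u) :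
    Continuous fun p : ℝ × ℝ³ => frobeniusNormSq (fderiv ℝ (lerayOrbit u p.1) p.2) := by
  have hU : ContDiff ℝ ∞ (Function.uncurry (lerayOrbit u)) := contDiff_uncurry_lerayOrbit hu.1
  have hU' : ContDiff ℝ ∞ (Function.uncurry fun (p : ℝ × ℝ³) (q : ℝ³) => lerayOrbit u p.1 q) := by
    have e : (Function.uncurry fun (p : ℝ × ℝ³) (q : ℝ³) => lerayOrbit u p.1 q) =
        Function.uncurry (lerayOrbit u) ∘ fun r : (ℝ × ℝ³) × ℝ³ => (r.1.1, r.2) := by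
      funext r; rfl
    rw [e]
    exact hU.comp ((contDiff_fst.comp contDiff_fst).prodMk contDiff_snd)
  have hD : ContDiff ℝ ∞ fun p : ℝ × ℝ³ => fderiv ℝ (lerayOrbit u p.1) p.2 :=
    hU'.fderiv (m := ∞) (n := ∞) contDiff_snd (by simp)
  have hc : Continuous fun p : ℝ × ℝ³ => fderiv ℝ (lerayOrbit u p.1) p.2 := hD.continuous
  unfold frobeniusNormSq
  exact continuous_finsetSum _ fun i _ => ((hc.clm_apply continuous_const).norm).pow 2

/-- `B_ρ` and its closure agree up to a null set (the sphere is Lebesgue-null). -/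
theorem ball_ae_eq_closedBall' (ρ : ℝ) :
    (ball (0 : ℝ³) ρ : Set ℝ³) =ᵐ[volume] (closedBall (0 : ℝ³) ρ : Set ℝ³) := by
  rw [← ball_union_sphere]
  exact (union_ae_eq_left_of_ae_eq_empty (ae_eq_empty.2 (Measure.addHaar_sphere volume _ _))).symm

/-- **stub_gradEnergyBasic (ii)**: continuity of `s ↦ E(ρ, s)`. -/
theorem continuous_ballGradEnergy (hu : IsTypeIAncientMild C u) (ρ : ℝ) :
    Continuous fun s => ∫ y in ball (0 : ℝ³) ρ, frobeniusNormSq (fderiv ℝ (lerayOrbit u s) y) := by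
  have e : (fun s => ∫ y in ball (0 : ℝ³) ρ, frobeniusNormSq (fderiv ℝ (lerayOrbit u s) y)) =
      fun s => ∫ y in closedBall (0 : ℝ³) ρ, frobeniusNormSq (fderiv ℝ (lerayOrbit u s) y) := by
    funext s
    exact setIntegral_congr_set (ball_ae_eq_closedBall' ρ)
  rw [e]
  exact continuous_parametric_integral_of_continuous
    (f := fun s y => frobeniusNormSq (fderiv ℝ (lerayOrbit u s) y))
    (continuous_frobeniusNormSq_fderiv_lerayOrbit_uncurry hu) (isCompact_closedBall _ _)

/-- **stub_gradEnergyBasic**, verbatim signature of the lead's stub, proved. -/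
theorem stub_gradEnergyBasic : ∀ (C : ℝ) (u : ℝ → ℝ³ → ℝ³), IsTypeIAncientMild C u →
    (∀ (ρ s : ℝ), 0 < ρ →
      0 ≤ ∫ y in Metric.ball (0 : ℝ³) ρ, frobeniusNormSq (fderiv ℝ (lerayOrbit u s) y)) ∧
    (∀ ρ : ℝ, 0 < ρ →
      Continuous fun s => ∫ y in Metric.ball (0 : ℝ³) ρ, frobeniusNormSq (fderiv ℝ (lerayOrbit u s) y)) ∧
    (∀ (s ρ ρ' : ℝ), 0 < ρ → ρ ≤ ρ' →
      ∫ y in Metric.ball (0 : ℝ³) ρ, frobeniusNormSq (fderiv ℝ (lerayOrbit u s) y) ≤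
        ∫ y in Metric.ball (0 : ℝ³) ρ', frobeniusNormSq (fderiv ℝ (lerayOrbit u s) y)) :=
  fun _C u hu => ⟨fun ρ s _ => ballGradEnergy_nonneg u ρ s, fun ρ _ => continuous_ballGradEnergy hu ρ,
    fun s ρ ρ' _ h => ballGradEnergy_mono hu s ρ ρ' h⟩

end Drefute
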